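import Summits.KontsevichZagierPeriods.KontsevichZagierPeriods.Theorems.TerasomaMultiplicationBetaCancellationOfPiCancellation
import Summits.KontsevichZagierPeriods.KontsevichZagierPeriods.Theorems.BetaCancellation.Negative.PiLink

/-!
# `BetaCancellation` (stmt-KontsevichZagierPeriods-13633) — exact reductions of the crux to its open core (unconditional)

Scratch header (lead c13): registered stub `betaCancellation_iff_unitSquare_and_half`, to be proved by a stub-worker.
-/

noncomputable section

set_option linter.dupNamespace false

namespace Summit.KontsevichZagierPeriods.KontsevichZagierPeriods.BetaCancellationLine

open MeasureTheory Set
open Literature.NumberTheory.Transcendental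
open Literature.NumberTheory.Transcendental.KZ
open Summit.KontsevichZagierPeriods.KontsevichZagierPeriods.BetaCancellationNegative
open Summit.KontsevichZagierPeriods.KontsevichZagierPeriods.Theses.TerasomaMultiplication
  (BetaCancellation)
open Summit.KontsevichZagierPeriods.GammaHodgeSectorKO (betaRep betaRep_domain betaRep_integrand)

/-! ## (i) Reduction to the half-open unit square `(0,1] × (0,1]` -/

/-- **Reduction to the unit square, unconditional**: `BetaCancellation` holds iff it holds for all
`(a,b) ∈ ((0,1] ∩ ℚ)²` — write `a = a₀ + A`, `b = b₀ + B` (`exists_frac_add_nat`), translate in `b`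
(`kernelCancellation_betaKernel_add_nat`), swap (`kernelCancellation_betaKernel_symm`), translate in
`a`, swap. [folklore] -/
theorem betaCancellation_iff_unitSquare :
    BetaCancellation ↔
      ∀ a b : ℚ, 0 < a → a ≤ 1 → 0 < b → b ≤ 1 → KernelCancellation (betaKernel a b) := by
  rw [betaCancellation_iff]
  refine ⟨fun h a b ha _ hb _ => h a b ha hb, fun h a b ha hb => ?_⟩
  obtain ⟨a₀, A, ha0, ha1, rfl⟩ := exists_frac_add_nat ha
  obtain ⟨b₀, B, hb0, hb1, rfl⟩ := exists_frac_add_nat hb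
  have h1 : KernelCancellation (betaKernel a₀ (b₀ + B)) :=
    kernelCancellation_betaKernel_add_nat ha0 hb0 (h a₀ b₀ ha0 ha1 hb0 hb1) B
  have h2 : KernelCancellation (betaKernel (b₀ + B) (a₀ + A)) :=
    kernelCancellation_betaKernel_add_nat (by positivity) ha0
      (kernelCancellation_betaKernel_symm (by positivity) ha0 h1) A
  exact kernelCancellation_betaKernel_symm (by positivity) (by positivity) h2

/-! ## (ii) Reduction to the single instance `a = b = 1/2` -/

/-- **`BetaCancellation ↔ KernelCancellation (β(1/2,1/2))`**: `→` is instantiation, `←` is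
`[β(1/2,1/2)] ∼ [π]` (`piCancellation_of_kernelCancellation_half`) followed by
`betaCancellation_of_piCancellation`. [folklore] -/
theorem betaCancellation_iff_half :
    BetaCancellation ↔ KernelCancellation (betaKernel (1/2) (1/2)) :=
  ⟨fun h => betaCancellation_iff.1 h (1/2) (1/2) (by norm_num) (by norm_num),
    fun h => betaCancellation_of_piCancellation (piCancellation_of_kernelCancellation_half h)⟩

/-! ## (iii) Reduction to each anti-diagonal instance `(b, 1 − b)`, `0 < b < 1` -/

/-- **Anti-diagonal cancellation implies `π`-cancellation**: if `KernelCancellation (β(b,1−b))`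
for some rational `0 < b < 1`, then `KZ.PiCancellation`. Proof: `c ≡ [r] − [r']`
(`exists_integralRep_sub`), `[π]·c ∈ relations ⇒ [π]×r ∼ [π]×r' ⇒ E×r ∼ E×r'` with
`E = sin(πb)·[β(b,1−b)] ∼ [π]` (Euler reflection inside the calculus, `stub_eulerReflection`),
cancel the scalar `sin(πb) ≠ 0`, and apply the hypothesis. [folklore] -/
theorem piCancellation_of_kernelCancellation_antidiagonal {b : ℚ} (hb : 0 < b) (hb1 : b < 1)
    (h : KernelCancellation (betaKernel b (1 - b))) : KZ.PiCancellation := by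
  intro c hc
  obtain ⟨n, m, r, r', hrel⟩ := exists_integralRep_sub_holds c
  have h1 : of piRep * (of r - of r') ∈ relations := by
    have h' : of piRep * (c - (of r - of r')) ∈ relations := mul_mem_relations_left_holds _ _ hrel
    have := relations.sub_mem hc h'
    rwa [← mul_sub, sub_sub_cancel] at this
  rw [mul_sub, of_mul_of, of_mul_of] at h1
  have h1b : 0 < 1 - b := by linarith
  have halg : IsAlgebraic ℚ (Real.sin (Real.pi * b)) := isAlgebraic_sin_pi_mul_rat hb
  have hs0 : Real.sin (Real.pi * b) ≠ 0 := (sin_pi_mul_pos hb hb1).ne'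
  have hEi : Set.EqOn ((betaRep b (1 - b) hb h1b).constMul (Real.sin (Real.pi * b)) halg).integrand
      (fun x => Real.sin (Real.pi * b) * (x 0) ^ ((b:ℝ) - 1) * (1 - x 0) ^ (-(b:ℝ)))
      ((betaRep b (1 - b) hb h1b).constMul (Real.sin (Real.pi * b)) halg).domain := by
    intro x _
    simp only [IntegralRep.integrand_constMul, betaRep_integrand, betaKernel, cast_one_sub_sub_one]
    ring
  have hE : Equivalent ((betaRep b (1 - b) hb h1b).constMul (Real.sin (Real.pi * b)) halg) piRep :=
    stub_eulerReflection b hb hb1 _ piRep rfl hEi rfl (fun _ _ => rfl)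
  have h2 : Equivalent (((betaRep b (1 - b) hb h1b).constMul (Real.sin (Real.pi * b)) halg).prod r)
      (((betaRep b (1 - b) hb h1b).constMul (Real.sin (Real.pi * b)) halg).prod r') :=
    ((Equivalent.prod hE (Equivalent.refl r)).trans h1).trans
      (Equivalent.prod hE (Equivalent.refl r')).symm
  rw [constMul_prod_eq, constMul_prod_eq] at h2
  have h3 : Equivalent ((betaRep b (1 - b) hb h1b).prod r) ((betaRep b (1 - b) hb h1b).prod r') :=
    equivalent_of_equivalent_constMul halg hs0 h2
  have h4 : Equivalent r r' :=
    h r r' _ _ (isPinned_betaRep_prod b (1 - b) hb h1b r) (isPinned_betaRep_prod b (1 - b) hb h1b r') h3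
  have := relations.add_mem hrel h4
  simpa using this

/-- **`BetaCancellation ↔ KernelCancellation (β(b,1−b))`** for every rational `0 < b < 1`: `→` is
instantiation, `←` is `piCancellation_of_kernelCancellation_antidiagonal` followed by
`betaCancellation_of_piCancellation`. [folklore] -/
theorem betaCancellation_iff_antidiagonal {b : ℚ} (hb : 0 < b) (hb1 : b < 1) :
    BetaCancellation ↔ KernelCancellation (betaKernel b (1 - b)) :=
  ⟨fun h => betaCancellation_iff.1 h b (1 - b) hb (by linarith),
    fun h => betaCancellation_of_piCancellation
      (piCancellation_of_kernelCancellation_antidiagonal hb hb1 h)⟩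

/-- **STUB `betaCancellation_iff_unitSquare_and_half`**: the crux is equivalent (i) to its instances on the
half-open unit square `(0,1] × (0,1]` (translation `b ↦ b + 1` is an EQUIVALENCE of cancellation statements, plus the
swap), (ii) to its SINGLE instance `a = b = 1/2`, and (iii) to each anti-diagonal instance `(b, 1 − b)`, `0 < b < 1`.
[folklore] -/
theorem betaCancellation_iff_unitSquare_and_half :
    (Summit.KontsevichZagierPeriods.KontsevichZagierPeriods.Theses.TerasomaMultiplication.BetaCancellation ↔
      ∀ a b : ℚ, 0 < a → a ≤ 1 → 0 < b → b ≤ 1 → KernelCancellation (betaKernel a b)) ∧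
    (Summit.KontsevichZagierPeriods.KontsevichZagierPeriods.Theses.TerasomaMultiplication.BetaCancellation ↔
      KernelCancellation (betaKernel (1/2) (1/2))) ∧
    (∀ b : ℚ, 0 < b → b < 1 →
      (Summit.KontsevichZagierPeriods.KontsevichZagierPeriods.Theses.TerasomaMultiplication.BetaCancellation ↔
        KernelCancellation (betaKernel b (1 - b)))) := by
  exact ⟨betaCancellation_iff_unitSquare, betaCancellation_iff_half,
    fun _ hb hb1 => betaCancellation_iff_antidiagonal hb hb1⟩

end Summit.KontsevichZagierPeriods.KontsevichZagierPeriods.BetaCancellationLine
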